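import Mathlib
import HarnessLib
import Literature.Analysis.FluidPDE.CurlFreeLiouville
import Literature.Analysis.FluidPDE.TaoEnstrophyLocalisation
import Summits.NavierStokesRegularity.NavierStokesRegularity.Theorems.LocalSineTubeDoorEnstrophyProductionProfileRigidity

/-!
# K2 `PoloidalWindowRigidity` (stmt-NavierStokesRegularity-19708), residue (G″): THE VERTICAL MEAN OF A PERIODIC
# POLOIDAL FIELD IS HORIZONTALLY RIGID — calculus and Liouville step of the vertically periodic stratum
# (CENSUS-K2G §16.3, mechanism M9; K2 lead nsreg-p7 gen 4)

Tools for the companion file `…VerticalPeriod` (the stratum theorem «vertically periodic poloidal profiles are trivial»):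

* `exists_iteratedFDeriv_two_rate_of_class` — the scale-sharp HESSIAN RATE of the class, `‖D²v(t)‖ ≤ C₃/((−t)√(−t))`
  (KNSS 2009 Prop. 4.1 with `k = 2` and its uniform constants; verbatim the route of `…ClassRate`, `k = 1`);
* `hasFDerivAt_verticalIntegral`, `norm_sub_verticalAverage_le`, `verticalIntegral_add_smul`,
  `verticalIntegral_fderiv_apply_self_eq_zero` — differentiation under the vertical integral `∫₀ᴸ f(· + z e) dz`,
  the Poincaré bound `‖f − (1/L)∫₀ᴸ f(· + z e)‖ ≤ L‖e‖ sup‖Df‖`, and height-independence under an `L`-period;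
* `inner_verticalMeanGradient_eq_zero` — **the mean horizontal flow of a vertically periodic, poloidal, incompressible,
  bounded `C²` field is rigid**: the vertical mean of `Du` maps into the vertical line.  The horizontal projection of the
  vertical mean `∫₀ᴸ u(· + z e₃) dz` is bounded, `C²`, curl-free (`(curl)₃ =` mean of `ω₃ = 0`, the other components are
  height-derivatives) and divergence-free, hence CONSTANT by the tree's Liouville lemma
  `eq_of_curl_eq_zero_of_isDivFree_of_bounded` (KNSS 2009 Lemma 3.1).

WHAT THIS IS NOT: not a proof of K2 and nothing about Clay (A) — support calculus for one settled stratum of the residue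
of crux `PoloidalWindowRigidity` (bears_on LADDER-NS N0, route PoloidalWindowDoor).
-/

noncomputable section

-- the summit and its single sub-problem share the name (CONVENTIONS §1), as in every Theorems file
set_option linter.dupNamespace false

namespace Summit.NavierStokesRegularity.NavierStokesRegularity.Theorems.PoloidalWindowDoorPoloidalWindowRigidityVerticalMean

open MeasureTheory Set Function Filter Topology TopologicalSpace Metric InnerProductSpace intervalIntegral
open scoped RealInnerProductSpace InnerProductSpace Laplacian ContDiff ENNReal Interval
open Literature.Analysis Literature.Analysis.FluidPDE
open Summit.NavierStokesRegularity.NavierStokesRegularity.Theorems.LocalSineTubeDoorProfileAlignedWindowRigidityAncient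
open Summit.NavierStokesRegularity.NavierStokesRegularity.Theorems.PoloidalWindowDoorPoloidalWindowRigidityWindow
open Summit.NavierStokesRegularity.NavierStokesRegularity.Theorems.PoloidalWindowDoorPoloidalWindowRigidityDegenerate
open Summit.NavierStokesRegularity.NavierStokesRegularity.Theorems.PoloidalWindowDoorPoloidalWindowRigidityClassRate
open Summit.NavierStokesRegularity.NavierStokesRegularity.Theorems.LocalSineTubeDoorBoundedSubsolutionMaxPrinciple
open Summit.NavierStokesRegularity.NavierStokesRegularity.Theorems.LocalSineTubeDoorEnstrophyProductionProfileRigidity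

variable {C : ℝ} {v : ℝ → EuclideanSpace ℝ (Fin 3) → EuclideanSpace ℝ (Fin 3)}

/-! ### the scale-sharp second-derivative rate of the class -/

/-- **THE SCALE-SHARP HESSIAN RATE ON THE CLASS.**  For a profile of the route's Type-I class there is ONE constant
`C₃` with `‖D²v(t)(y)‖ ≤ C₃/((−t)√(−t))` for every `t < 0` and every `y` (KNSS 2009 Prop. 4.1, `k = 2`, with its
uniform constants, restarted at the datum time `(1+δ)t` — verbatim the route of `…ClassRate.exists_fderiv_rate_of_class`). -/
theorem exists_iteratedFDeriv_two_rate_of_class (hrate : HasTypeITimeDecay C v)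
    (hcont : ContinuousOn (uncurry v) (Iio (0 : ℝ) ×ˢ univ))
    (hmild : ∀ s t : ℝ, s < t → t < 0 → ∀ y,
      v t y = UnboundedOperators.heatExtension (v s) (t - s) y - oseenDuhamel 1 s v v t y) :
    ∃ C₃ : ℝ, ∀ t < 0, ∀ y, ‖iteratedFDeriv ℝ 2 (v t) y‖ ≤ C₃ / ((-t) * Real.sqrt (-t)) := by
  obtain ⟨ε, hε, CL, hCL, hL⟩ := knss2009_local_smoothing_holds (EuclideanSpace ℝ (Fin 3)) 2 0
  set C' : ℝ := max C 1 with hC'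
  have hC'1 : 1 ≤ C' := le_max_right _ _
  have hC'0 : 0 < C' := lt_of_lt_of_le one_pos hC'1
  have hCC' : C ≤ C' := le_max_left _ _
  set δ : ℝ := ε / (4 * C' ^ 2) with hδ
  have hδ0 : 0 < δ := div_pos hε (by positivity)
  refine ⟨CL * C' * Real.sqrt 2 / δ, fun t ht y => ?_⟩
  have hnt : 0 < -t := neg_pos.2 ht
  set s' : ℝ := t - δ * (-t) with hs'
  have hs't : s' < t := by rw [hs']; nlinarith
  have hs'0 : s' < 0 := hs't.trans ht
  have hT : s' < t / 2 := by linarith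
  set M : ℝ := C' * Real.sqrt 2 / Real.sqrt (-t) with hM
  have hsq0 : 0 < Real.sqrt (-t) := Real.sqrt_pos.2 hnt
  have hM0 : 0 < M := div_pos (mul_pos hC'0 (Real.sqrt_pos.2 two_pos)) hsq0
  have hbound : ∀ τ < t / 2, ∀ x, ‖v τ x‖ ≤ M := by
    intro τ hτ x
    have hτ0 : τ < 0 := by linarith
    refine (hrate τ hτ0 x).trans ?_
    have h1 : C / Real.sqrt (-τ) ≤ C' / Real.sqrt (-τ) :=
      div_le_div_of_nonneg_right hCC' (Real.sqrt_nonneg _)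
    refine h1.trans ?_
    rw [hM, div_le_div_iff₀ (Real.sqrt_pos.2 (by linarith)) hsq0]
    have h2 : Real.sqrt (-t) ≤ Real.sqrt 2 * Real.sqrt (-τ) := by
      rw [← Real.sqrt_mul (by norm_num : (0:ℝ) ≤ 2)]
      exact Real.sqrt_le_sqrt (by linarith)
    calc C' * Real.sqrt (-t) ≤ C' * (Real.sqrt 2 * Real.sqrt (-τ)) :=
          mul_le_mul_of_nonneg_left h2 hC'0.le
      _ = C' * Real.sqrt 2 * Real.sqrt (-τ) := by ring
  have ha : AEStronglyMeasurable (v s') volume := (continuous_slice hcont hs'0).aestronglyMeasurable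
  have haM : eLpNorm (v s') ∞ volume ≤ ENNReal.ofReal M := by
    rw [eLpNorm_exponent_top]
    exact eLpNormEssSup_le_of_ae_bound (Eventually.of_forall fun x => hbound _ (by linarith) x)
  have hsub : Ioo s' (t / 2) ×ˢ (univ : Set (EuclideanSpace ℝ (Fin 3))) ⊆ Iio 0 ×ˢ univ :=
    prod_mono (fun τ hτ => lt_trans hτ.2 (by linarith)) subset_rfl
  have hu : AEStronglyMeasurable (uncurry v) (volume.restrict (Ioo s' (t / 2) ×ˢ univ)) :=
    (hcont.mono hsub).aestronglyMeasurable (measurableSet_Ioo.prod MeasurableSet.univ)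
  have hub : ∀ τ ∈ Ioo s' (t / 2), eLpNorm (v τ) ∞ volume ≤ ENNReal.ofReal M := by
    intro τ hτ
    rw [eLpNorm_exponent_top]
    exact eLpNormEssSup_le_of_ae_bound (Eventually.of_forall fun x => hbound τ hτ.2 x)
  have hmild' : ∀ τ ∈ Ioo s' (t / 2), v τ =ᵐ[volume] fun x =>
      UnboundedOperators.heatExtension (v s') (1 * (τ - s')) x - oseenDuhamel 1 s' v v τ x := fun τ hτ =>
    Eventually.of_forall fun x => by
      rw [one_mul]; exact hmild s' τ hτ.1 (by linarith [hτ.2]) x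
  obtain ⟨w, -, -, hrep, -, hbd⟩ :=
    exists_local_smooth_representative hL one_pos hM0 hCL ha haM hu hub hmild'
  have hM2 : M ^ 2 = 2 * C' ^ 2 / (-t) := by
    rw [hM, div_pow, mul_pow, Real.sq_sqrt (by norm_num : (0:ℝ) ≤ 2), Real.sq_sqrt hnt.le]
    ring
  have hq : ε * 1 / M ^ 2 = ε * (-t) / (2 * C' ^ 2) := by
    rw [hM2]
    field_simp
  have hδlt : δ * (-t) < ε * (-t) / (2 * C' ^ 2) := by
    rw [hδ, lt_div_iff₀ (by positivity)]
    have h1 : ε / (4 * C' ^ 2) * -t * (2 * C' ^ 2) = ε * -t / 2 := by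
      field_simp
      ring
    rw [h1]
    linarith [mul_pos hε hnt]
  have hwin : t < s' + ε * 1 / M ^ 2 := by
    rw [hq, hs']
    linarith
  have htmem : t ∈ Ioo s' (min (s' + ε * 1 / M ^ 2) (t / 2)) := ⟨hs't, lt_min hwin (by linarith)⟩
  have htmem' : t ∈ Ioo s' (s' + ε * 1 / M ^ 2) := ⟨hs't, hwin⟩
  have hvw : v t = w t := by
    funext x
    rw [← hrep t htmem x, one_mul]
    exact hmild s' t hs't ht x
  have h := hbd t htmem' y
  have hid : (fun y' => iteratedDeriv 0 (fun τ => w τ y') t) = w t := by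
    funext y'; rw [iteratedDeriv_zero]
  have hts : t - s' = δ * (-t) := by rw [hs']; ring
  have hexp : ((2 : ℕ) : ℝ) / 2 = 1 := by norm_num
  rw [hid, ← hvw, hexp, Real.rpow_one, pow_zero, mul_one, one_mul, hts] at h
  -- `δ(−t) ‖D²v‖ ≤ CL M = CL C' √2/√(−t)`
  have hpos : 0 < δ * (-t) := mul_pos hδ0 hnt
  have h2 : ‖iteratedFDeriv ℝ 2 (v t) y‖ ≤ CL * M / (δ * (-t)) := by
    rw [le_div_iff₀ hpos]; linarith
  refine h2.trans (le_of_eq ?_)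
  rw [hM]
  field_simp

/-! ### vertical averages: calculus -/

/-- Differentiation under the vertical integral: for a `C¹` map `f` with bounded derivative,
`x ↦ ∫₀ᴸ f(x + z e) dz` has derivative `∫₀ᴸ Df(x + z e) dz`. -/
theorem hasFDerivAt_verticalIntegral {F : Type*} [NormedAddCommGroup F] [NormedSpace ℝ F] [CompleteSpace F]
    {f : EuclideanSpace ℝ (Fin 3) → F} (hf : ContDiff ℝ 1 f) {B : ℝ} (hB : ∀ y, ‖fderiv ℝ f y‖ ≤ B)
    (e : EuclideanSpace ℝ (Fin 3)) (L : ℝ) (x : EuclideanSpace ℝ (Fin 3)) :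
    HasFDerivAt (fun x' => ∫ z in (0:ℝ)..L, f (x' + z • e)) (∫ z in (0:ℝ)..L, fderiv ℝ f (x + z • e)) x := by
  have hfc : Continuous f := hf.continuous
  have hfdc : Continuous (fderiv ℝ f) := hf.continuous_fderiv one_ne_zero
  have hcz : ∀ x' : EuclideanSpace ℝ (Fin 3), Continuous fun z : ℝ => x' + z • e := fun x' =>
    continuous_const.add (continuous_id.smul continuous_const)
  refine intervalIntegral.hasFDerivAt_integral_of_dominated_of_fderiv_le (𝕜 := ℝ) (μ := volume)
    (F := fun x' z => f (x' + z • e)) (F' := fun x' z => fderiv ℝ f (x' + z • e)) (s := univ) (bound := fun _ => B)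
    univ_mem ?_ ?_ ?_ ?_ ?_ ?_
  · exact Eventually.of_forall fun x' => (hfc.comp (hcz x')).aestronglyMeasurable
  · exact (hfc.comp (hcz x)).intervalIntegrable _ _
  · exact (hfdc.comp (hcz x)).aestronglyMeasurable
  · exact Eventually.of_forall fun z _ x' _ => hB _
  · exact intervalIntegrable_const
  · refine Eventually.of_forall fun z _ x' _ => ?_
    have h1 : HasFDerivAt (fun x'' : EuclideanSpace ℝ (Fin 3) => x'' + z • e)
        (ContinuousLinearMap.id ℝ (EuclideanSpace ℝ (Fin 3))) x' := (hasFDerivAt_id x').add_const _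
    have h2 := ((hf.differentiable one_ne_zero) (x' + z • e)).hasFDerivAt.comp x' h1
    rw [ContinuousLinearMap.comp_id] at h2
    exact h2

/-- Poincaré along a vertical period (crude form): `‖f(x) − (1/L)∫₀ᴸ f(x + z e) dz‖ ≤ L ‖e‖ · sup‖Df‖`. -/
theorem norm_sub_verticalAverage_le {F : Type*} [NormedAddCommGroup F] [NormedSpace ℝ F] [CompleteSpace F]
    {f : EuclideanSpace ℝ (Fin 3) → F} (hf : ContDiff ℝ 1 f) {B : ℝ} (hB : ∀ y, ‖fderiv ℝ f y‖ ≤ B)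
    (e : EuclideanSpace ℝ (Fin 3)) {L : ℝ} (hL : 0 < L) (x : EuclideanSpace ℝ (Fin 3)) :
    ‖f x - (1 / L) • ∫ z in (0:ℝ)..L, f (x + z • e)‖ ≤ L * ‖e‖ * B := by
  have hB0 : 0 ≤ B := (norm_nonneg _).trans (hB x)
  have hfc : Continuous f := hf.continuous
  have hcz : Continuous fun z : ℝ => x + z • e := continuous_const.add (continuous_id.smul continuous_const)
  -- `f x = (1/L) ∫₀ᴸ f x dz`
  have hconst : f x = (1 / L) • ∫ _ in (0:ℝ)..L, f x := by
    rw [intervalIntegral.integral_const, sub_zero, smul_smul, one_div, inv_mul_cancel₀ hL.ne', one_smul]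
  have hint1 : IntervalIntegrable (fun _ : ℝ => f x) volume 0 L := intervalIntegrable_const
  have hint2 : IntervalIntegrable (fun z : ℝ => f (x + z • e)) volume 0 L := (hfc.comp hcz).intervalIntegrable _ _
  rw [hconst, ← smul_sub, ← intervalIntegral.integral_sub hint1 hint2, norm_smul]
  -- pointwise: `‖f x − f (x + z e)‖ ≤ B ‖z e‖ ≤ B L ‖e‖` on `[0, L]`
  have hpt : ∀ z ∈ Ι (0:ℝ) L, ‖f x - f (x + z • e)‖ ≤ L * ‖e‖ * B := by
    intro z hz
    rw [uIoc_of_le hL.le] at hz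
    have hmvt : ‖f (x + z • e) - f x‖ ≤ B * ‖x + z • e - x‖ :=
      convex_univ.norm_image_sub_le_of_norm_fderiv_le (fun y _ => (hf.differentiable one_ne_zero) y)
        (fun y _ => hB y) (mem_univ _) (mem_univ _)
    rw [add_sub_cancel_left, norm_smul, Real.norm_eq_abs, abs_of_pos hz.1] at hmvt
    rw [norm_sub_rev]
    refine hmvt.trans ?_
    have hzL : z * ‖e‖ ≤ L * ‖e‖ := mul_le_mul_of_nonneg_right hz.2 (norm_nonneg _)
    nlinarith [norm_nonneg e]
  have hI := intervalIntegral.norm_integral_le_of_norm_le_const hpt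
  rw [sub_zero, abs_of_pos hL] at hI
  calc ‖(1 / L : ℝ)‖ * ‖∫ z in (0:ℝ)..L, (f x - f (x + z • e))‖
      ≤ ‖(1 / L : ℝ)‖ * (L * ‖e‖ * B * L) := mul_le_mul_of_nonneg_left hI (norm_nonneg _)
    _ = L * ‖e‖ * B := by
        rw [Real.norm_eq_abs, abs_of_pos (one_div_pos.2 hL)]
        field_simp

/-- Vertical periodicity makes the vertical integral independent of the height. -/
theorem verticalIntegral_add_smul {F : Type*} [NormedAddCommGroup F] [NormedSpace ℝ F]
    (f : EuclideanSpace ℝ (Fin 3) → F) (e : EuclideanSpace ℝ (Fin 3)) {L : ℝ}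
    (hper : ∀ y, f (y + L • e) = f y) (x : EuclideanSpace ℝ (Fin 3)) (a : ℝ) :
    ∫ z in (0:ℝ)..L, f (x + a • e + z • e) = ∫ z in (0:ℝ)..L, f (x + z • e) := by
  set g : ℝ → F := fun z => f (x + z • e) with hg
  have hgp : Function.Periodic g L := fun z => by
    simp only [hg]
    rw [add_smul, ← add_assoc, hper]
  have h1 : (fun z : ℝ => f (x + a • e + z • e)) = fun z => g (z + a) := by
    funext z
    simp only [hg]
    congr 1
    rw [add_smul, add_assoc, add_comm (a • e)]
  rw [h1, intervalIntegral.integral_comp_add_right (fun z => g z) a, zero_add, add_comm L a]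
  have h2 := hgp.intervalIntegral_add_eq a 0
  rw [zero_add] at h2
  exact h2

/-- The derivative of a height-independent vertical integral vanishes along `e`. -/
theorem verticalIntegral_fderiv_apply_self_eq_zero {F : Type*} [NormedAddCommGroup F] [NormedSpace ℝ F]
    [CompleteSpace F] {f : EuclideanSpace ℝ (Fin 3) → F} (hf : ContDiff ℝ 1 f) {B : ℝ}
    (hB : ∀ y, ‖fderiv ℝ f y‖ ≤ B) (e : EuclideanSpace ℝ (Fin 3)) {L : ℝ} (hper : ∀ y, f (y + L • e) = f y)
    (x : EuclideanSpace ℝ (Fin 3)) :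
    (∫ z in (0:ℝ)..L, fderiv ℝ f (x + z • e)) e = 0 := by
  have hI := hasFDerivAt_verticalIntegral hf hB e L x
  -- the curve `a ↦ I (x + a • e)` is constant
  have hc : HasDerivAt (fun a : ℝ => x + a • e) e 0 := by
    have h := ((hasDerivAt_id (0:ℝ)).smul_const e).const_add x
    simpa using h
  have hx0 : x + (0:ℝ) • e = x := by simp
  have hI0 : HasFDerivAt (fun x' => ∫ z in (0:ℝ)..L, f (x' + z • e)) (∫ z in (0:ℝ)..L, fderiv ℝ f (x + z • e))
      (x + (0:ℝ) • e) := by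
    rw [hx0]; exact hI
  have hcomp : HasDerivAt (fun a : ℝ => ∫ z in (0:ℝ)..L, f (x + a • e + z • e))
      ((∫ z in (0:ℝ)..L, fderiv ℝ f (x + z • e)) e) 0 := by
    have h := hI0.comp_hasDerivAt (0:ℝ) hc
    simpa only [Function.comp_def] using h
  have hconst : (fun a : ℝ => ∫ z in (0:ℝ)..L, f (x + a • e + z • e)) = fun _ => ∫ z in (0:ℝ)..L, f (x + z • e) := by
    funext a; exact verticalIntegral_add_smul f e hper x a
  rw [hconst] at hcomp
  exact hcomp.unique (hasDerivAt_const (0:ℝ) _)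

/-- **The mean horizontal flow of a vertically periodic poloidal incompressible field is rigid.**  For a `C²` field
`u` on `ℝ³`, bounded with bounded first and second derivatives, divergence-free, poloidal along `e₃`
(`⟪curl u, e₃⟫ ≡ 0`) and `L`-periodic in `x₃`, the vertical mean of the velocity gradient takes values in the vertical
line: `⟪(∫₀ᴸ Du(y + z e₃) dz) a, b⟫ = 0` for every `a` and every horizontal `b`.  (The horizontal projection of the
vertical mean `∫₀ᴸ u(· + z e₃) dz` is a bounded `C²` field with vanishing curl and divergence, constant by the tree's
Liouville lemma `eq_of_curl_eq_zero_of_isDivFree_of_bounded`, KNSS 2009 Lemma 3.1.) -/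
theorem inner_verticalMeanGradient_eq_zero {u : EuclideanSpace ℝ (Fin 3) → EuclideanSpace ℝ (Fin 3)}
    (hu : ContDiff ℝ 2 u) {B₀ B₁ B₂ : ℝ} (hB₀ : ∀ y, ‖u y‖ ≤ B₀) (hB₁ : ∀ y, ‖fderiv ℝ u y‖ ≤ B₁)
    (hB₂ : ∀ y, ‖fderiv ℝ (fderiv ℝ u) y‖ ≤ B₂) (hdiv : VectorCalculus.IsDivFree u)
    (hpol : ∀ y, ⟪curl u y, EuclideanSpace.single 2 (1 : ℝ)⟫_ℝ = 0) (L : ℝ)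
    (hper : ∀ y, u (y + L • EuclideanSpace.single 2 (1 : ℝ)) = u y)
    (y a b : EuclideanSpace ℝ (Fin 3)) (hb : ⟪b, EuclideanSpace.single 2 (1 : ℝ)⟫_ℝ = 0) :
    ⟪(∫ z in (0:ℝ)..L, fderiv ℝ u (y + z • EuclideanSpace.single 2 (1 : ℝ))) a, b⟫_ℝ = 0 := by
  set e₃ : EuclideanSpace ℝ (Fin 3) := EuclideanSpace.single 2 (1 : ℝ) with he₃
  have hu1 : ContDiff ℝ 1 u := hu.of_le (by norm_num)
  have hDu1 : ContDiff ℝ 1 (fderiv ℝ u) := hu.fderiv_right le_rfl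
  -- the vertical integral, its derivative and second derivative
  set I : EuclideanSpace ℝ (Fin 3) → EuclideanSpace ℝ (Fin 3) := fun x => ∫ z in (0:ℝ)..L, u (x + z • e₃) with hIdef
  set DI : EuclideanSpace ℝ (Fin 3) → (EuclideanSpace ℝ (Fin 3) →L[ℝ] EuclideanSpace ℝ (Fin 3)) :=
    fun x => ∫ z in (0:ℝ)..L, fderiv ℝ u (x + z • e₃) with hDIdef
  set D2I : EuclideanSpace ℝ (Fin 3) →
      (EuclideanSpace ℝ (Fin 3) →L[ℝ] EuclideanSpace ℝ (Fin 3) →L[ℝ] EuclideanSpace ℝ (Fin 3)) :=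
    fun x => ∫ z in (0:ℝ)..L, fderiv ℝ (fderiv ℝ u) (x + z • e₃) with hD2Idef
  have hI : ∀ x, HasFDerivAt I (DI x) x := fun x => hasFDerivAt_verticalIntegral hu1 hB₁ e₃ L x
  have hDI : ∀ x, HasFDerivAt DI (D2I x) x := fun x => hasFDerivAt_verticalIntegral hDu1 hB₂ e₃ L x
  have hD2Ic : Continuous D2I := by
    have hc : Continuous (fderiv ℝ (fderiv ℝ u)) := hDu1.continuous_fderiv one_ne_zero
    have h2 : Continuous (Function.uncurry fun (x : EuclideanSpace ℝ (Fin 3)) (z : ℝ) =>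
        fderiv ℝ (fderiv ℝ u) (x + z • e₃)) :=
      hc.comp (continuous_fst.add (continuous_snd.smul continuous_const))
    exact intervalIntegral.continuous_parametric_intervalIntegral_of_continuous' h2 0 L
  have hI2 : ContDiff ℝ 2 I := by
    rw [show (2 : WithTop ℕ∞) = ((1 : ℕ) : WithTop ℕ∞) + 1 by norm_num, contDiff_succ_iff_hasFDerivAt]
    refine ⟨DI, ?_, hI⟩
    rw [show ((1 : ℕ) : WithTop ℕ∞) = ((0 : ℕ) : WithTop ℕ∞) + 1 by norm_num, contDiff_succ_iff_hasFDerivAt]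
    exact ⟨D2I, contDiff_zero.2 hD2Ic, hDI⟩
  -- `z`-independence: `DI x e₃ = 0`
  have hDIe : ∀ x, DI x e₃ = 0 := fun x => verticalIntegral_fderiv_apply_self_eq_zero hu1 hB₁ e₃ hper x
  -- the horizontal projection `P w = w − ⟪e₃, w⟫ e₃`
  set P : EuclideanSpace ℝ (Fin 3) →L[ℝ] EuclideanSpace ℝ (Fin 3) :=
    ContinuousLinearMap.id ℝ _ - (innerSL ℝ e₃).smulRight e₃ with hPdef
  have hP_apply : ∀ w : EuclideanSpace ℝ (Fin 3), P w = w - ⟪e₃, w⟫_ℝ • e₃ := fun w => by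
    simp [hPdef]
  have he₃i : ∀ w : EuclideanSpace ℝ (Fin 3), ⟪e₃, w⟫_ℝ = w 2 := fun w => by
    rw [he₃, EuclideanSpace.inner_single_left]; simp
  have he₃2 : e₃ 2 = 1 := by simp [he₃]
  have he₃0 : e₃ 0 = 0 := by simp [he₃]
  have he₃1 : e₃ 1 = 0 := by simp [he₃]
  have hP2 : ∀ w : EuclideanSpace ℝ (Fin 3), P w 2 = 0 := fun w => by
    rw [hP_apply, he₃i, PiLp.sub_apply, PiLp.smul_apply, he₃2, smul_eq_mul, mul_one, sub_self]
  have hP0 : ∀ w : EuclideanSpace ℝ (Fin 3), P w 0 = w 0 := fun w => by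
    rw [hP_apply, PiLp.sub_apply, PiLp.smul_apply, he₃0, smul_zero, sub_zero]
  have hP1 : ∀ w : EuclideanSpace ℝ (Fin 3), P w 1 = w 1 := fun w => by
    rw [hP_apply, PiLp.sub_apply, PiLp.smul_apply, he₃1, smul_zero, sub_zero]
  set V : EuclideanSpace ℝ (Fin 3) → EuclideanSpace ℝ (Fin 3) := fun x => P (I x) with hVdef
  have hV2 : ContDiff ℝ 2 V := P.contDiff.comp hI2
  have hVd : ∀ x, HasFDerivAt V (P.comp (DI x)) x := fun x => P.hasFDerivAt.comp x (hI x)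
  have hVfd : ∀ x, fderiv ℝ V x = P.comp (DI x) := fun x => (hVd x).fderiv
  have hD : ∀ x w, fderiv ℝ V x w = P (DI x w) := fun x w => by rw [hVfd x]; rfl
  -- integrability of the slices of the integrands
  have hci : ∀ x, Continuous fun z : ℝ => fderiv ℝ u (x + z • e₃) := fun x =>
    (hu1.continuous_fderiv one_ne_zero).comp (continuous_const.add (continuous_id.smul continuous_const))
  have hint : ∀ x, IntervalIntegrable (fun z : ℝ => fderiv ℝ u (x + z • e₃)) volume 0 L := fun x =>
    (hci x).intervalIntegrable _ _
  have hciw : ∀ x (w : EuclideanSpace ℝ (Fin 3)) (i : Fin 3),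
      Continuous fun z : ℝ => fderiv ℝ u (x + z • e₃) w i := fun x w i =>
    (EuclideanSpace.proj i : EuclideanSpace ℝ (Fin 3) →L[ℝ] ℝ).continuous.comp ((hci x).clm_apply continuous_const)
  -- components of `DI x w`: `(DI x w) i = ∫ (Du(x + z e₃) w) i`
  have hDIcomp : ∀ x (w : EuclideanSpace ℝ (Fin 3)) (i : Fin 3),
      DI x w i = ∫ z in (0:ℝ)..L, fderiv ℝ u (x + z • e₃) w i := by
    intro x w i
    have h1 : DI x w = ∫ z in (0:ℝ)..L, fderiv ℝ u (x + z • e₃) w := by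
      simp only [hDIdef]
      exact ContinuousLinearMap.intervalIntegral_apply (hint x) w
    rw [h1]
    have hint' : IntervalIntegrable (fun z : ℝ => fderiv ℝ u (x + z • e₃) w) volume 0 L :=
      ((hci x).clm_apply continuous_const).intervalIntegrable _ _
    have h2 := (EuclideanSpace.proj i : EuclideanSpace ℝ (Fin 3) →L[ℝ] ℝ).intervalIntegral_comp_comm hint'
    exact h2.symm
  -- the third component of the mean of `curl u` vanishes
  have hpol2 : ∀ y', fderiv ℝ u y' (EuclideanSpace.single 0 1) 1 - fderiv ℝ u y' (EuclideanSpace.single 1 1) 0 = 0 := by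
    intro y'
    have h := hpol y'
    rw [EuclideanSpace.inner_single_right] at h
    have h' : curl u y' 2 = 0 := by simpa using h
    simpa [curl] using h'
  -- the trace of `Du` vanishes
  have hdiv3 : ∀ y', fderiv ℝ u y' (EuclideanSpace.single 0 1) 0 + fderiv ℝ u y' (EuclideanSpace.single 1 1) 1 =
      -(fderiv ℝ u y' (EuclideanSpace.single 2 1) 2) := by
    intro y'
    have h := hdiv y'
    rw [divergence_eq_sum_inner_fderiv (EuclideanSpace.basisFun (Fin 3) ℝ), Fin.sum_univ_three] at h
    simp only [EuclideanSpace.basisFun_apply, EuclideanSpace.inner_single_left, map_one, one_mul] at h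
    linarith
  -- curl V = 0
  have hcurlV : ∀ x, curl V x = 0 := by
    intro x
    have hA : ∀ w, fderiv ℝ V x w 2 = 0 := fun w => by rw [hD]; exact hP2 _
    have hB : ∀ i, fderiv ℝ V x (EuclideanSpace.single 2 1) i = 0 := fun i => by
      rw [hD, show (EuclideanSpace.single 2 (1:ℝ) : EuclideanSpace ℝ (Fin 3)) = e₃ from rfl, hDIe x, map_zero]
      rfl
    have hC : fderiv ℝ V x (EuclideanSpace.single 0 1) 1 - fderiv ℝ V x (EuclideanSpace.single 1 1) 0 = 0 := by
      rw [hD, hD, hP1, hP0, hDIcomp, hDIcomp,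
        ← intervalIntegral.integral_sub ((hciw x _ _).intervalIntegrable _ _) ((hciw x _ _).intervalIntegrable _ _)]
      simp only [hpol2, intervalIntegral.integral_zero]
    have h0 : curl V x 0 = 0 := by
      rw [show curl V x 0 = fderiv ℝ V x (EuclideanSpace.single 1 1) 2 - fderiv ℝ V x (EuclideanSpace.single 2 1) 1
        by simp [curl], hA, hB, sub_zero]
    have h1 : curl V x 1 = 0 := by
      rw [show curl V x 1 = fderiv ℝ V x (EuclideanSpace.single 2 1) 0 - fderiv ℝ V x (EuclideanSpace.single 0 1) 2
        by simp [curl], hA, hB, sub_zero]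
    have h2 : curl V x 2 = 0 := by
      rw [show curl V x 2 = fderiv ℝ V x (EuclideanSpace.single 0 1) 1 - fderiv ℝ V x (EuclideanSpace.single 1 1) 0
        by simp [curl], hC]
    ext i
    fin_cases i
    · simpa using h0
    · simpa using h1
    · simpa using h2
  -- div V = 0
  have hdivV : VectorCalculus.IsDivFree V := by
    intro x
    rw [divergence_eq_sum_inner_fderiv (EuclideanSpace.basisFun (Fin 3) ℝ), Fin.sum_univ_three]
    simp only [EuclideanSpace.basisFun_apply, EuclideanSpace.inner_single_left, map_one, one_mul]
    have hB2 : fderiv ℝ V x (EuclideanSpace.single 2 1) 2 = 0 := by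
      rw [hD, show (EuclideanSpace.single 2 (1:ℝ) : EuclideanSpace ℝ (Fin 3)) = e₃ from rfl, hDIe x, map_zero]
      rfl
    rw [hB2, add_zero, hD, hD, hP0, hP1, hDIcomp, hDIcomp,
      ← intervalIntegral.integral_add ((hciw x _ _).intervalIntegrable _ _) ((hciw x _ _).intervalIntegrable _ _)]
    simp only [hdiv3]
    rw [intervalIntegral.integral_neg, ← hDIcomp, show (EuclideanSpace.single 2 (1:ℝ) : EuclideanSpace ℝ (Fin 3)) = e₃
      from rfl, hDIe x]
    simp
  -- V is bounded
  have hVbd : ∀ x, ‖V x‖ ≤ ‖P‖ * (B₀ * |L - 0|) := by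
    intro x
    have hIx : ‖I x‖ ≤ B₀ * |L - 0| :=
      intervalIntegral.norm_integral_le_of_norm_le_const fun z _ => hB₀ _
    exact (P.le_opNorm (I x)).trans (mul_le_mul_of_nonneg_left hIx (norm_nonneg _))
  -- Liouville: V is constant, so its derivative vanishes
  have hVconst : ∀ x, V x = V 0 := fun x => eq_of_curl_eq_zero_of_isDivFree_of_bounded hV2 hcurlV hdivV hVbd x 0
  have hVf : (V : EuclideanSpace ℝ (Fin 3) → EuclideanSpace ℝ (Fin 3)) = fun _ => V 0 := funext hVconst
  have hDV0 : ∀ x w, P (DI x w) = 0 := by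
    intro x w
    rw [← hD, hVf]
    simp
  -- conclusion: `DI y a = ⟪e₃, DI y a⟫ e₃` is vertical
  have hsplit : DI y a = P (DI y a) + ⟪e₃, DI y a⟫_ℝ • e₃ := by rw [hP_apply]; abel
  rw [show (∫ z in (0:ℝ)..L, fderiv ℝ u (y + z • e₃)) = DI y from rfl, hsplit, hDV0, zero_add,
    real_inner_smul_left, real_inner_comm b e₃, hb, mul_zero]

end Summit.NavierStokesRegularity.NavierStokesRegularity.Theorems.PoloidalWindowDoorPoloidalWindowRigidityVerticalMean

end
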